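import Literature.NumberTheory.CubicFields.IndexPSubrings
import Mathlib.Algebra.CubicDiscriminant
import Mathlib.Algebra.Field.ZMod
import Mathlib.Data.Set.Card
import HarnessLib

/-!
# BTT Lemma 2.3 (ii) for `q = p`: a cubic ring has at most `3` subrings of index `p` if `p ∤ ct`, at most `p + 1` in general

Topic `Literature/NumberTheory/CubicFields`; the count announced in `IndexPSubrings.lean`: an
index-`p` subring `H ⊆ R(g)` is the lattice of a line `ℓ ∈ ℙ¹(𝔽_p)` on which `g` vanishes mod `p`.

Bhargava–Taniguchi–Thorne 2023, Lemma 2.3 (ii) ([BBP], [TT_rc]): "For any ring `R'`, the number of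
`R` contained in `R'` with index `q` is bounded above by `∏_{p ∣ q, p ∤ ct(R')} 3 ∏_{p ∣ q, p ∣ ct(R')} (p+1)`."
Here `q = p` is prime, `R' = R(g)`, and "an `R` contained in `R'` with index `p`" is the image
`H = φ(R(f))` of an injective `φ : R(f) ↪ R(g)` with `|detOnQuot φ| = p` (every cubic ring being an
`R(f)`, Levi–Delone–Faddeev):

* `indexPImages g p` — the set of these images `H ⊆ R(g)`;
* `lineOf p s t ∈ Option (ZMod p)` — the line `[s : t] ∈ ℙ¹(𝔽_p)` (`none = [0 : 1]`, `some m = [1 : m]`),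
  `lineOf_eq_of_dvd`, `lineLattice_eq_of_lineOf_eq` — it classifies the lattices of lines;
* **`ncard_indexPImages_le_succ`** — at most `p + 1` index-`p` subrings (one per line);
* **`ncard_indexPImages_le_three`** — **at most `3` when `p ∤ ct(g)`**: the line of `H` is a zero of
  `g (mod p)` (`dvd_eval_of_range`), i.e. `[0:1]` with `p ∣ d`, or `[1:m]` with
  `a + bm + cm² + dm³ ≡ 0`; a nonzero binary cubic over `𝔽_p` has at most `3` zeros in `ℙ¹(𝔽_p)`.

-- TODO(general form): squarefree `q` (multiplicativity over `p ∣ q`), as printed.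

## References

* M. Bhargava, T. Taniguchi, F. Thorne, *Improved error estimates for the Davenport–Heilbronn
  theorems*, Math. Ann. 389 (2024) = arXiv:2107.12819, Lemma 2.3 (ii) [BhargavaTaniguchiThorne2023].
-/

namespace Literature.NumberTheory.CubicFields

namespace RingOfForm

open BinaryCubic Polynomial

variable {g : BinaryCubic ℤ} {p : ℕ}

/-- **The index-`p` subrings of `R(g)`** (as subsets): images of injective `φ : R(f) ↪ R(g)` with
`|detOnQuot φ| = p`. [cite: BhargavaTaniguchiThorne2023, Lemma 2.3 (ii) (the R contained in R' with index p)] -/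
def indexPImages (g : BinaryCubic ℤ) (p : ℕ) : Set (Set (RingOfForm g)) :=
  {H | ∃ (f : BinaryCubic ℤ) (φ : RingOfForm f →+* RingOfForm g),
    Function.Injective φ ∧ (detOnQuot φ).natAbs = p ∧ H = Set.range φ}

/-! ### Lines in `ℙ¹(𝔽_p)` as `Option (ZMod p)` -/

/-- The line `[s : t] ∈ ℙ¹(𝔽_p)`: `none` for `[0 : 1]` (`s ≡ 0`), `some (t/s)` otherwise. [folklore] -/
noncomputable def lineOf (p : ℕ) (s t : ℤ) : Option (ZMod p) :=
  if (s : ZMod p) = 0 then none else some ((t : ZMod p) * ((s : ZMod p))⁻¹)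

/-- A pair `≢ (0, 0) (mod p)` with `s ≡ 0` has `t ≢ 0`. [folklore] -/
theorem cast_ne_zero_of_cast_eq_zero {s t : ℤ} (hnd : ¬ ((p : ℤ) ∣ s ∧ (p : ℤ) ∣ t)) (hs : (s : ZMod p) = 0) :
    (t : ZMod p) ≠ 0 := by
  intro ht
  rw [ZMod.intCast_zmod_eq_zero_iff_dvd] at hs ht
  exact hnd ⟨hs, ht⟩

/-- The cubic `g(1, m) = a + bm + cm² + dm³` over `𝔽_p`, as a Mathlib `Cubic` (leading coefficient `d`). [folklore] -/
def modCubic (g : BinaryCubic ℤ) (p : ℕ) : Cubic (ZMod p) :=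
  ⟨(g.d : ZMod p), (g.c : ZMod p), (g.b : ZMod p), (g.a : ZMod p)⟩

/-- Evaluation of `modCubic`. [folklore] -/
theorem eval_modCubic (m : ZMod p) :
    (modCubic g p).toPoly.eval m = (g.a : ZMod p) + (g.b : ZMod p) * m + (g.c : ZMod p) * m ^ 2 + (g.d : ZMod p) * m ^ 3 := by
  simp only [modCubic, Cubic.toPoly, eval_add, eval_mul, eval_C, eval_pow, eval_X]
  ring

/-- `modCubic g p = 0` iff `g` is a multiple of `p`. [folklore] -/
theorem modCubic_toPoly_eq_zero_iff : (modCubic g p).toPoly = 0 ↔ g.IsMultiple p := by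
  rw [Cubic.toPoly_eq_zero_iff, IsMultiple]
  constructor
  · intro h
    have ha : (modCubic g p).d = 0 := by rw [h]; rfl
    have hb : (modCubic g p).c = 0 := by rw [h]; rfl
    have hc : (modCubic g p).b = 0 := by rw [h]; rfl
    have hd : (modCubic g p).a = 0 := by rw [h]; rfl
    simp only [modCubic] at ha hb hc hd
    rw [ZMod.intCast_zmod_eq_zero_iff_dvd] at ha hb hc hd
    exact ⟨ha, hb, hc, hd⟩
  · rintro ⟨ha, hb, hc, hd⟩
    rw [← ZMod.intCast_zmod_eq_zero_iff_dvd] at ha hb hc hd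
    simp only [modCubic, ha, hb, hc, hd]
    rfl

variable [hp : Fact p.Prime]

/-- **Collinear nondegenerate pairs have the same line.** [folklore] -/
theorem lineOf_eq_of_dvd {s t s' t' : ℤ} (hnd : ¬ ((p : ℤ) ∣ s ∧ (p : ℤ) ∣ t)) (hnd' : ¬ ((p : ℤ) ∣ s' ∧ (p : ℤ) ∣ t'))
    (h : (p : ℤ) ∣ s' * t - t' * s) : lineOf p s t = lineOf p s' t' := by
  have h' : (s' : ZMod p) * t = (t' : ZMod p) * s := by
    have := (ZMod.intCast_zmod_eq_zero_iff_dvd (s' * t - t' * s) p).mpr h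
    push_cast at this
    exact sub_eq_zero.mp this
  unfold lineOf
  by_cases hs : (s : ZMod p) = 0
  · have ht := cast_ne_zero_of_cast_eq_zero hnd hs
    have hs' : (s' : ZMod p) = 0 := by
      rw [hs, mul_zero] at h'
      exact (mul_eq_zero.mp h').resolve_right ht
    rw [if_pos hs, if_pos hs']
  · have hs' : (s' : ZMod p) ≠ 0 := by
      intro hs'
      rw [hs', zero_mul] at h'
      have ht' : (t' : ZMod p) = 0 := (mul_eq_zero.mp h'.symm).resolve_right hs
      exact cast_ne_zero_of_cast_eq_zero hnd' hs' ht'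
    rw [if_neg hs, if_neg hs', Option.some_inj]
    field_simp
    linear_combination h'

/-- **The line determines the lattice**: equal lines give equal `lineLattice`s. [folklore] -/
theorem lineLattice_eq_of_lineOf_eq {s t s' t' : ℤ} (hnd : ¬ ((p : ℤ) ∣ s ∧ (p : ℤ) ∣ t)) (hnd' : ¬ ((p : ℤ) ∣ s' ∧ (p : ℤ) ∣ t'))
    (h : lineOf p s t = lineOf p s' t') : lineLattice g p s t = lineLattice g p s' t' := by
  -- membership is a condition mod `p`
  have hmem : ∀ (s t : ℤ) (P : RingOfForm g), P ∈ lineLattice g p s t ↔ (P.y : ZMod p) * t - (P.z : ZMod p) * s = 0 := by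
    intro s t P
    rw [mem_lineLattice, ← ZMod.intCast_zmod_eq_zero_iff_dvd]
    push_cast
    rfl
  ext P
  rw [hmem, hmem]
  unfold lineOf at h
  by_cases hs : (s : ZMod p) = 0
  · have ht := cast_ne_zero_of_cast_eq_zero hnd hs
    by_cases hs' : (s' : ZMod p) = 0
    · have ht' := cast_ne_zero_of_cast_eq_zero hnd' hs'
      simp only [hs, hs', mul_zero, sub_zero]
      constructor
      · intro hy; rw [(mul_eq_zero.mp hy).resolve_right ht, zero_mul]
      · intro hy; rw [(mul_eq_zero.mp hy).resolve_right ht', zero_mul]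
    · rw [if_pos hs, if_neg hs'] at h; exact absurd h (by simp)
  · by_cases hs' : (s' : ZMod p) = 0
    · rw [if_neg hs, if_pos hs'] at h; exact absurd h (by simp)
    · rw [if_neg hs, if_neg hs', Option.some_inj] at h
      -- `t/s = t'/s'`, i.e. `t s' = t' s`
      have hts : (t : ZMod p) * s' = (t' : ZMod p) * s := by
        have := h; field_simp at this; linear_combination this
      constructor
      · intro hP
        -- multiply by `s'`, divide by `s`
        have : ((P.y : ZMod p) * t' - (P.z : ZMod p) * s') * s = ((P.y : ZMod p) * t - (P.z : ZMod p) * s) * s' := by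
          linear_combination (P.y : ZMod p) * hts.symm
        rw [hP, zero_mul] at this
        exact (mul_eq_zero.mp this).resolve_right hs
      · intro hP
        have : ((P.y : ZMod p) * t - (P.z : ZMod p) * s) * s' = ((P.y : ZMod p) * t' - (P.z : ZMod p) * s') * s := by
          linear_combination (P.y : ZMod p) * hts
        rw [hP, zero_mul] at this
        exact (mul_eq_zero.mp this).resolve_right hs'

/-! ### The line of an index-`p` image, and the injection into `Option (ZMod p)` -/

/-- Data of an index-`p` image: an injective `φ` of index `p` with `H = φ(R f)`, and a vector
`w ∈ H` nondegenerate mod `p`. [folklore] -/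
theorem exists_witness {H : Set (RingOfForm g)} (hH : H ∈ indexPImages g p) :
    ∃ (f : BinaryCubic ℤ) (φ : RingOfForm f →+* RingOfForm g) (w : RingOfForm g),
      Function.Injective φ ∧ (detOnQuot φ).natAbs = p ∧ H = Set.range φ ∧ w ∈ Set.range φ ∧
      ¬ ((p : ℤ) ∣ w.y ∧ (p : ℤ) ∣ w.z) := by
  obtain ⟨f, φ, hφ, hdet, rfl⟩ := hH
  obtain ⟨w, hw, hnd⟩ := exists_mem_range_not_dvd φ hp.out.one_lt hdet
  exact ⟨f, φ, w, hφ, hdet, rfl, hw, hnd⟩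

/-- **The line of an index-`p` subring** (through any nondegenerate vector of it). [folklore] -/
noncomputable def lineOfImage (H : indexPImages g p) : Option (ZMod p) :=
  lineOf p (exists_witness H.2).choose_spec.choose_spec.choose.y (exists_witness H.2).choose_spec.choose_spec.choose.z

/-- **An index-`p` subring is determined by its line**: `lineOfImage` is injective. [folklore] -/
theorem lineOfImage_injective : Function.Injective (lineOfImage (g := g) (p := p)) := by
  rintro ⟨H, hH⟩ ⟨H', hH'⟩ h
  obtain ⟨hφ, hdet, hHe, hw, hnd⟩ := (exists_witness hH).choose_spec.choose_spec.choose_spec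
  obtain ⟨hφ', hdet', hHe', hw', hnd'⟩ := (exists_witness hH').choose_spec.choose_spec.choose_spec
  apply Subtype.ext
  change H = H'
  rw [hHe, hHe', range_eq_lineLattice _ hp.out hφ hdet hw hnd, range_eq_lineLattice _ hp.out hφ' hdet' hw' hnd']
  exact lineLattice_eq_of_lineOf_eq hnd hnd' h

/-- The set of index-`p` images is finite. [folklore] -/
theorem indexPImages_finite (g : BinaryCubic ℤ) (p : ℕ) [Fact p.Prime] : (indexPImages g p).Finite :=
  Set.finite_coe_iff.mp (Finite.of_injective _ (lineOfImage_injective (g := g) (p := p)))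

/-- **At most `p + 1` subrings of index `p`** (one per line of `ℙ¹(𝔽_p)`; BTT Lemma 2.3 (ii), the
factor `p + 1`). [cite: BhargavaTaniguchiThorne2023, Lemma 2.3 (ii) (at most p + 1 subrings of index p)] -/
theorem ncard_indexPImages_le_succ (g : BinaryCubic ℤ) (p : ℕ) [Fact p.Prime] : (indexPImages g p).ncard ≤ p + 1 := by
  classical
  rw [← Nat.card_coe_set_eq]
  calc Nat.card (indexPImages g p) ≤ Nat.card (Option (ZMod p)) :=
        Nat.card_le_card_of_injective _ lineOfImage_injective
    _ = p + 1 := by rw [Nat.card_eq_fintype_card, Fintype.card_option, ZMod.card]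

/-! ### At most `3` when `p ∤ ct(g)` -/

/-- **The line of a nondegenerate zero of `g (mod p)` is a zero-line**: if `p ∣ g(s, t)` then either
`s ≡ 0` and `p ∣ d`, or `s ≢ 0` and `m = t/s` is a root of `a + bm + cm² + dm³` over `𝔽_p`. [folklore] -/
theorem lineOf_mem_of_dvd_eval {s t : ℤ} (hnd : ¬ ((p : ℤ) ∣ s ∧ (p : ℤ) ∣ t)) (hdvd : (p : ℤ) ∣ g.eval s t) :
    (lineOf p s t = none ∧ (g.d : ZMod p) = 0) ∨
      ∃ m : ZMod p, lineOf p s t = some m ∧ (modCubic g p).toPoly.eval m = 0 := by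
  have h0 : (g.a : ZMod p) * s ^ 3 + (g.b : ZMod p) * s ^ 2 * t + (g.c : ZMod p) * s * t ^ 2 + (g.d : ZMod p) * t ^ 3 = 0 := by
    have := (ZMod.intCast_zmod_eq_zero_iff_dvd (g.eval s t) p).mpr hdvd
    rw [BinaryCubic.eval] at this
    push_cast at this
    linear_combination this
  unfold lineOf
  by_cases hs : (s : ZMod p) = 0
  · left
    refine ⟨by rw [if_pos hs], ?_⟩
    have ht := cast_ne_zero_of_cast_eq_zero hnd hs
    rw [hs] at h0
    simp only [zero_pow (by norm_num : (3 : ℕ) ≠ 0), zero_pow (by norm_num : (2 : ℕ) ≠ 0), mul_zero, zero_mul,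
      zero_add] at h0
    exact (mul_eq_zero.mp h0).resolve_right (pow_ne_zero 3 ht)
  · right
    refine ⟨(t : ZMod p) * ((s : ZMod p))⁻¹, by rw [if_neg hs], ?_⟩
    rw [eval_modCubic]
    have h3 : (s : ZMod p) ^ 3 ≠ 0 := pow_ne_zero 3 hs
    -- divide `h0` by `s³`
    have : ((g.a : ZMod p) + (g.b : ZMod p) * (t * (s : ZMod p)⁻¹) + (g.c : ZMod p) * (t * (s : ZMod p)⁻¹) ^ 2 +
        (g.d : ZMod p) * (t * (s : ZMod p)⁻¹) ^ 3) * (s : ZMod p) ^ 3 = 0 := by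
      rw [← h0]; field_simp
    exact (mul_eq_zero.mp this).resolve_right h3

/-- The finite set of zero-lines of `g (mod p)` (meaningful when `g ≢ 0 (mod p)`). [folklore] -/
noncomputable def zeroLines (g : BinaryCubic ℤ) (p : ℕ) [Fact p.Prime] : Finset (Option (ZMod p)) := by
  classical
  exact (if (g.d : ZMod p) = 0 then {none} else ∅) ∪ ((modCubic g p).toPoly.roots.toFinset.map ⟨some, Option.some_injective _⟩)

/-- **A nonzero binary cubic over `𝔽_p` has at most `3` zeros in `ℙ¹(𝔽_p)`**: `#zeroLines ≤ 3`
when `p ∤ ct(g)`. [folklore] -/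
theorem card_zeroLines_le_three (hct : ¬ g.IsMultiple p) : (zeroLines g p).card ≤ 3 := by
  classical
  have hP0 : (modCubic g p).toPoly ≠ 0 := fun h => hct (modCubic_toPoly_eq_zero_iff.mp h)
  have hroots : ((modCubic g p).toPoly.roots.toFinset.map ⟨some, Option.some_injective _⟩).card ≤ (modCubic g p).toPoly.natDegree := by
    rw [Finset.card_map]
    exact (Multiset.toFinset_card_le _).trans (card_roots' _)
  unfold zeroLines
  refine (Finset.card_union_le _ _).trans ?_
  by_cases hd : (g.d : ZMod p) = 0
  · rw [if_pos hd, Finset.card_singleton]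
    have h2 : (modCubic g p).toPoly.natDegree ≤ 2 := Cubic.natDegree_of_a_eq_zero (by simpa [modCubic] using hd)
    omega
  · rw [if_neg hd, Finset.card_empty, zero_add]
    have h3 : (modCubic g p).toPoly.natDegree = 3 := Cubic.natDegree_of_a_ne_zero (by simpa [modCubic] using hd)
    omega

/-- The line of an index-`p` image is a zero-line of `g (mod p)` (when `p ∤ ct(g)`). [folklore] -/
theorem lineOfImage_mem_zeroLines (hct : ¬ g.IsMultiple p) (H : indexPImages g p) : lineOfImage H ∈ zeroLines g p := by
  classical
  have hP0 : (modCubic g p).toPoly ≠ 0 := fun h => hct (modCubic_toPoly_eq_zero_iff.mp h)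
  obtain ⟨hφ, hdet, -, hw, hnd⟩ := (exists_witness H.2).choose_spec.choose_spec.choose_spec
  have hdvd := dvd_eval_of_range _ hp.out hφ hdet hw hnd
  unfold zeroLines lineOfImage
  rw [Finset.mem_union]
  rcases lineOf_mem_of_dvd_eval hnd hdvd with ⟨hl, hd⟩ | ⟨m, hl, hm⟩
  · left
    rw [hl, if_pos hd]
    exact Finset.mem_singleton_self _
  · right
    rw [hl, Finset.mem_map]
    exact ⟨m, Multiset.mem_toFinset.mpr ((mem_roots hP0).mpr hm), rfl⟩

/-- **BTT Lemma 2.3 (ii), `q = p`, `p ∤ ct(R')`: a cubic ring `R' = R(g)` with `p ∤ ct(g)` has at most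
`3` subrings of index `p`.** [cite: BhargavaTaniguchiThorne2023, Lemma 2.3 (ii) (at most 3 subrings of index p when p ∤ ct(R'))] -/
theorem ncard_indexPImages_le_three (hct : ¬ g.IsMultiple p) : (indexPImages g p).ncard ≤ 3 := by
  classical
  rw [← Nat.card_coe_set_eq]
  calc Nat.card (indexPImages g p) ≤ Nat.card (zeroLines g p) :=
        Nat.card_le_card_of_injective (fun H => (⟨lineOfImage H, lineOfImage_mem_zeroLines hct H⟩ : zeroLines g p))
          (fun H H' h => lineOfImage_injective (congrArg Subtype.val h))
    _ = (zeroLines g p).card := by rw [Nat.card_eq_fintype_card, Fintype.card_coe]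
    _ ≤ 3 := card_zeroLines_le_three hct

end RingOfForm

end Literature.NumberTheory.CubicFields
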